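import Mathlib
import Summits.ResolutionOfSingularities.ResolutionOfSingularities.Theorems.RadicialJungCleanModelsCleanLU3CompositeCdivCP
import HarnessLib

/-!
# Route `RadicialJung`, crux `CleanModels` (stmt-15917): the two entry points of the printed stub F-02 in LU³ form

Seat `decomp-res-hand-1` g6 (hand 1 of 2, stubs 1–4 of the registered skeleton `Cruxes/CleanModels/Lines/Sketch.lean` rev 35, sha16 `de44649d8f729c3b`).
OURS · counted 0 · DEF-FREE · nothing here proves resolution of singularities in characteristic `p`; the printed theorems stay hypotheses.

BOOKKEEPING FACT recorded by this file (memo `Cruxes/CleanModels/Lines/Sketch-memo-hand1-g6.md` §2): the registered printed stub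
`stub_cossartPiltant2019 : CossartPiltant2019.{0}` (F-02: weak resolution of reduced separated schemes of finite type of dimension `≤ 3` over EVERY
field of EVERY characteristic) enters the whole orbit of the crux through exactly two leaves, both of which only use Cossart–Piltant's LOCAL
UNIFORMIZATION in dimension `≤ 3` over the crux's own ground field `k` (`Literature.AlgebraicGeometry.Resolution.LocalUniformization3 k`,
`ArithmeticalThreefolds.lean` :191; obtained from F-02 by ✓ `CossartPiltant2019.lu3`):

* leaf (i) — ✓ `exists_regular_model_containing_of_cp` (`…CleanLU3CompositeCdivCP.lean`; the (C-div) slice, and through `fun k _ => hCP.lu3 k` the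
  T-slices `Lens5.PRankTwoAssembly.* / Lens5TFrame.*` and ✓ `Lens5.TwistModel.exists_regular_model_subfield (hLU : LocalUniformization3 k)`), which
  already calls `hCP.lu3`;
* leaf (ii) — ✓ `Ccurve.exists_regular_model_mem_of_cossartPiltant2019` (`…CcurveModelWithT.lean`; head of the (C-curve)/composite slice
  ✓ `Ccurve.cleanLU3Defect_of_properCoarsening`), which applies F-02 to the affine scheme `Spec A[t]` and extracts the model at the centre of `O` by the
  valuative criterion — an instance of `LocalUniformization3 k` as well.

This file gives leaf (i) and leaf (ii) VERBATIM from the hypothesis `hLU : LocalUniformization3 k` (resp. from the typed named fact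
`CossartPiltant2019LU3.{0}`, `ArithmeticalThreefolds.lean` :237), so that a line lead may re-point stub 2 to the (LU³, characteristic-`p`) shape
`∀ (k : Type) [Field k], CharP k p → LocalUniformization3.{0} k` (or to `CossartPiltant2019LU3.{0}`) by threading alone.  What that removes from the
BY-NAME debt of stub 2 (kernel bookkeeping ✓ `cossartPiltant2019_iff`, ✓ `CossartPiltant2019Patching_holds`, ✓ `CossartPiltant2019.lu3`:
`CossartPiltant2019 ↔ (∀ k, ResolutionOverUpToDim k 2) ∧ (∀ k, LocalUniformization3 k)`): resolution over fields of characteristic `0`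
(tree leaf `CossartPiltant2019LUCompleteChar0` ⟸ `Temkin2008` / `Hironaka1964_local`) and the global surface-resolution/patching layer; what it does
NOT remove: Cossart–Piltant's local theorem (`CossartPiltant2019Local`) and its reduction (`CossartPiltant2019ReductionP`,
`CossartPiltant2019LU3OfComplete`) — the stub stays a PRINTED THEOREM (size XXL), by-name count unchanged.

* `exists_regular_model_containing_of_lu3` — leaf (i) from `LocalUniformization3 k`;
* `exists_regular_model_containing_dim_of_lu3` — the same with the dimension of the local ring at a CLOSED centre (`= dim A`);
* `Ccurve.exists_regular_model_mem_of_lu3` — leaf (ii) verbatim (binder list of ✓ `Ccurve.exists_regular_model_mem_of_cossartPiltant2019` with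
  `hCP` replaced by `hLU`);
* `exists_regular_model_containing_of_cp2019LU3`, `Ccurve.exists_regular_model_mem_of_cp2019LU3` — the same from the typed named fact
  `CossartPiltant2019LU3.{0}` BY NAME.

The registered F-02 leaf ✓ `Ccurve.exists_regular_model_mem_of_cossartPiltant2019 hCP …` is `Ccurve.exists_regular_model_mem_of_lu3 k K (hCP.lu3 k) …`
(checked on the farm; not restated, dedup).
-/

noncomputable section

set_option linter.dupNamespace false -- mandated namespace of this single-conjunct summit

open IsLocalRing
open Literature.AlgebraicGeometry.Resolution

namespace Summit.ResolutionOfSingularities.ResolutionOfSingularities.Theorems.RadicialJung.CleanModels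

variable {K : Type} [Field K] {k : Type} [Field k] [Algebra k K]

/-- **A regular model containing prescribed elements, from local uniformization in dimension `≤ 3` over `k`** (Cossart–Piltant 2019, §4.1 (LU),
the `k`-instance `LocalUniformization3 k`): for a finitely generated `k`-model `A ⊆ O` of `K = Frac A` of dimension `≤ 3`, ANY valuation ring `O` and a
finite `t ⊆ O`, some finitely generated `k`-model `A₃ ⊇ A ∪ t` inside `O` is regular at the centre of `O`.  Leaf (i): ✓ `exists_regular_model_containing_of_cp`
is this lemma applied to `hCP.lu3 k`. [cite: CossartPiltant2019, Thm. 1.1 and §4.1 (LU)] -/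
theorem exists_regular_model_containing_of_lu3 (hLU : LocalUniformization3 k)
    (O : ValuationSubring K) (A : Subalgebra k K) (hAO : A.toSubring ≤ O.toSubring) (hAfg : A.FG) [IsFractionRing A K]
    (hdimA : ringKrullDim A ≤ 3) (t : Finset K) (htO : (↑t : Set K) ⊆ O) :
    ∃ A₃ : Subalgebra k K, A₃.toSubring ≤ O.toSubring ∧ A ≤ A₃ ∧ A₃.FG ∧ (↑t : Set K) ⊆ A₃ ∧
      IsRegularLocalRing (locAtCentre A₃.toSubring O) := by
  classical
  -- the `k`-model `R = A[t]`
  obtain ⟨R, hReq, hAR, hRfg⟩ := exists_subalgebra_closure A t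
  have htR : (↑t : Set K) ⊆ R := fun z hz => by
    change z ∈ R.toSubring
    rw [hReq]
    exact Subring.subset_closure (Or.inr hz)
  have hRO : R.toSubring ≤ O.toSubring := by
    rw [hReq, Subring.closure_le]
    rintro z (hz | hz)
    · exact hAO hz
    · exact htO hz
  haveI hRfrac : IsFractionRing R K := isFractionRing_of_le hAR inferInstance
  have hdimR : ringKrullDim R ≤ 3 := by
    rw [ringKrullDim_eq_of_fg_of_le hAfg (hRfg hAfg) hAR]; exact hdimA
  -- local uniformization along `O` (Cossart–Piltant 2019, (LU) over `k`)
  obtain ⟨A₃, hA₃O, hRA₃, hA₃fg, hreg⟩ := hLU K O R hRO (hRfg hAfg) hRfrac hdimR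
  refine ⟨A₃, hA₃O, hAR.trans hRA₃, hA₃fg, fun z hz => hRA₃ (htR hz), ?_⟩
  exact (isRegularLocalRing_locAtCentre_iff hA₃O).mpr hreg

/-- **The same with the dimension at a closed centre**: if every centre above `A` is a closed point (`hzd`) and `dim A = d ≤ 3`, the regular model
`A₃ ⊇ A ∪ t` of `exists_regular_model_containing_of_lu3` has `dim (locAtCentre A₃ O) = d` (affine dimension formula at a maximal centre,
✓ `ringKrullDim_locAtCentre_eq_of_isMaximal`, and `dim A₃ = dim A`, ✓ `ringKrullDim_eq_of_fg_of_le`). [cite: CossartPiltant2019, §4.1 (LU)] -/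
theorem exists_regular_model_containing_dim_of_lu3 (hLU : LocalUniformization3 k)
    (O : ValuationSubring K) (A : Subalgebra k K) (hAO : A.toSubring ≤ O.toSubring) (hAfg : A.FG) [IsFractionRing A K]
    {d : ℕ} (hdimA : ringKrullDim A = d) (hd3 : d ≤ 3)
    (hzd : ∀ (T : Subring K) (hT : T ≤ O.toSubring), A.toSubring ≤ T → (subringCentre T O hT).IsMaximal)
    (t : Finset K) (htO : (↑t : Set K) ⊆ O) :
    ∃ A₃ : Subalgebra k K, A₃.toSubring ≤ O.toSubring ∧ A ≤ A₃ ∧ A₃.FG ∧ (↑t : Set K) ⊆ A₃ ∧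
      IsRegularLocalRing (locAtCentre A₃.toSubring O) ∧ ringKrullDim (locAtCentre A₃.toSubring O) = d := by
  have hdimA' : ringKrullDim A ≤ 3 := by
    rw [hdimA]
    exact_mod_cast hd3
  obtain ⟨A₃, hA₃O, hAA₃, hA₃fg, htA₃, hreg⟩ :=
    exists_regular_model_containing_of_lu3 hLU O A hAO hAfg hdimA' t htO
  refine ⟨A₃, hA₃O, hAA₃, hA₃fg, htA₃, hreg, ?_⟩
  rw [ringKrullDim_locAtCentre_eq_of_isMaximal A₃ hA₃fg O hA₃O (hzd _ hA₃O fun z hz => hAA₃ hz),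
    ringKrullDim_eq_of_fg_of_le hAfg hA₃fg hAA₃, hdimA]

/-- Leaf (i) from the typed named fact `CossartPiltant2019LU3` BY NAME (`ArithmeticalThreefolds.lean` :237, Cossart–Piltant 2019 (LU) in dimension
`≤ 3` over every field). [cite: CossartPiltant2019, Thm. 1.1 and §4.1 (LU)] -/
theorem exists_regular_model_containing_of_cp2019LU3 (hLU3 : CossartPiltant2019LU3.{0})
    (O : ValuationSubring K) (A : Subalgebra k K) (hAO : A.toSubring ≤ O.toSubring) (hAfg : A.FG) [IsFractionRing A K]
    (hdimA : ringKrullDim A ≤ 3) (t : Finset K) (htO : (↑t : Set K) ⊆ O) :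
    ∃ A₃ : Subalgebra k K, A₃.toSubring ≤ O.toSubring ∧ A ≤ A₃ ∧ A₃.FG ∧ (↑t : Set K) ⊆ A₃ ∧
      IsRegularLocalRing (locAtCentre A₃.toSubring O) :=
  exists_regular_model_containing_of_lu3 (hLU3 k) O A hAO hAfg hdimA t htO

namespace Ccurve

/-- **Leaf (ii) in LU³ form — a model regular at the centre of `O` containing a prescribed element `t ∈ O`** (binder list of
✓ `Ccurve.exists_regular_model_mem_of_cossartPiltant2019` VERBATIM, with `hCP : CossartPiltant2019.{0}` replaced by `hLU : LocalUniformization3 k`):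
for `A ⊆ O` finitely generated over `k` with `Frac A = K`, `dim A = d ≤ 3`, all centres above `A` closed, and `t ∈ O`, there is a finitely generated
`B ⊇ A` inside `O` with `t ∈ B` and `locAtCentre B O` regular of dimension `d`.  No scheme, no resolution morphism, no valuative criterion: one call to
(LU) over `k` on the model `A[t]`. [cite: CossartPiltant2019, Thm. 1.1 and §4.1 (LU)] -/
theorem exists_regular_model_mem_of_lu3
    (k : Type) [Field k] (K : Type) [Field K] [Algebra k K] (hLU : LocalUniformization3 k)
    (O : ValuationSubring K) (A : Subalgebra k K) (hAO : A.toSubring ≤ O.toSubring) (hAfg : A.FG)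
    (hfr : IsFractionRing A K) {d : ℕ} (hdimA : ringKrullDim A = d) (hd3 : d ≤ 3)
    (hzd : ∀ (T : Subring K) (hT : T ≤ O.toSubring), A.toSubring ≤ T → (subringCentre T O hT).IsMaximal)
    (t : K) (ht : t ∈ O) :
    ∃ (B : Subalgebra k K), B.toSubring ≤ O.toSubring ∧ A ≤ B ∧ B.FG ∧ t ∈ B ∧
      IsRegularLocalRing (locAtCentre B.toSubring O) ∧ ringKrullDim (locAtCentre B.toSubring O) = d := by
  classical
  haveI := hfr
  have htO : (↑({t} : Finset K) : Set K) ⊆ O := by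
    intro z hz
    rw [Finset.coe_singleton, Set.mem_singleton_iff] at hz
    subst hz
    exact ht
  obtain ⟨B, hBO, hAB, hBfg, htB, hreg, hdim⟩ :=
    exists_regular_model_containing_dim_of_lu3 hLU O A hAO hAfg hdimA hd3 hzd {t} htO
  exact ⟨B, hBO, hAB, hBfg, htB (by simp), hreg, hdim⟩

/-- Leaf (ii) from the typed named fact `CossartPiltant2019LU3` BY NAME. [cite: CossartPiltant2019, Thm. 1.1 and §4.1 (LU)] -/
theorem exists_regular_model_mem_of_cp2019LU3 (hLU3 : CossartPiltant2019LU3.{0})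
    (k : Type) [Field k] (K : Type) [Field K] [Algebra k K]
    (O : ValuationSubring K) (A : Subalgebra k K) (hAO : A.toSubring ≤ O.toSubring) (hAfg : A.FG)
    (hfr : IsFractionRing A K) {d : ℕ} (hdimA : ringKrullDim A = d) (hd3 : d ≤ 3)
    (hzd : ∀ (T : Subring K) (hT : T ≤ O.toSubring), A.toSubring ≤ T → (subringCentre T O hT).IsMaximal)
    (t : K) (ht : t ∈ O) :
    ∃ (B : Subalgebra k K), B.toSubring ≤ O.toSubring ∧ A ≤ B ∧ B.FG ∧ t ∈ B ∧
      IsRegularLocalRing (locAtCentre B.toSubring O) ∧ ringKrullDim (locAtCentre B.toSubring O) = d :=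
  exists_regular_model_mem_of_lu3 k K (hLU3 k) O A hAO hAfg hfr hdimA hd3 hzd t ht

-- Consistency with the registered leaf: the F-02 form ✓ `Ccurve.exists_regular_model_mem_of_cossartPiltant2019` (same statement with
-- `hCP : CossartPiltant2019.{0}`) is `exists_regular_model_mem_of_lu3 k K (hCP.lu3 k) …` — F-02 is used through (LU) over `k` only
-- (not restated here: the gate's dedup forbids a second copy of a landed statement).

end Ccurve

end Summit.ResolutionOfSingularities.ResolutionOfSingularities.Theorems.RadicialJung.CleanModels

end
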